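import Mathlib
import Literature.Combinatorics.SimpleGraph.HamiltonianCycleListings
import Summits.PneNP.PneNP.Theorems.SymmetryBudgetHamCompilesDefs
import Summits.PneNP.PneNP.Theorems.SymmetryBudgetHamCompilesStubKotzigAux

/-!
# Stub `stub_kotzig` of line `kotzig-cutspan` (crux `SymmetryBudget.HamCompiles`,
stmt-PneNP-10637) — auxiliary file 3

Route `PneNP/SymmetryBudget`, crux `Summit.PneNP.PneNP.Theses.SymmetryBudget.HamCompiles`, line
`kotzig-cutspan`, stub `stub_kotzig` (`G.IsHamiltonian ↔ KotzigPred G F`).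

Graph-side preliminaries of the backward direction (`isHamiltonian_of_kotzigPred`, auxiliary
file 5): oriented traversals of vertex sequences, elementary facts on path covers
`IsCoverOf`, and the translation of the data of `KotzigPred G F` into the abstract two-coloured
system of auxiliary files 2 and 5: the half-edges are the path ends, `(k, false)` = first vertex and
`(k, true)` = last vertex of the `k`-th path; an F-end `u` is labelled by its class key
`nbA G F u` (`lf`), an A-end by the declared label of its path (`la`).  Balance of
`KotzigPred` is balance of the system (`balanced_of_slots`), reachability in `junctionGraph`
gives its connectivity in closure form (`closure_of_reachable`).
-/

-- `Summit.PneNP.PneNP.…` duplicates `PneNP` BY DESIGN (single-problem summit, D-0017).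
set_option linter.dupNamespace false

namespace Summit.PneNP.PneNP.Theorems.HamCompilesKC

open Finset


/-! ### Oriented traversals of vertex sequences -/

namespace VSeq

variable {V : Type*}

/-! The vertex at end `b` of a path `p` (`false` = first, `true` = last) is
`bif b then p.last else p.first`; the vertex list traversed entering at end `b` is
`bif b then p.verts.reverse else p.verts` (no new definitions are introduced). -/

/-- A vertex sequence is nonempty. -/
theorem verts_ne_nil (p : VSeq V) : p.verts ≠ [] := List.cons_ne_nil _ _

/-- A traversal is nonempty. -/
theorem trav_ne_nil (p : VSeq V) (b : Bool) : (bif b then p.verts.reverse else p.verts) ≠ [] := by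
  cases b <;> simp [verts_ne_nil]

/-- A traversal lists the vertices of the path. -/
theorem mem_trav {p : VSeq V} {b : Bool} {v : V} :
    v ∈ (bif b then p.verts.reverse else p.verts) ↔ v ∈ p.verts := by
  cases b <;> simp

/-- A traversal starts at the entry end. -/
theorem head_trav (p : VSeq V) (b : Bool) :
    (bif b then p.verts.reverse else p.verts).head (trav_ne_nil p b) =
      bif b then p.last else p.first := by
  cases b
  · rfl
  · show p.verts.reverse.head _ = p.last
    rw [List.head_reverse]
    rfl

/-- A traversal ends at the exit end. -/
theorem getLast_trav (p : VSeq V) (b : Bool) :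
    (bif b then p.verts.reverse else p.verts).getLast (trav_ne_nil p b) =
      bif b then p.first else p.last := by
  cases b
  · rfl
  · show p.verts.reverse.getLast _ = p.first
    rw [List.getLast_reverse]
    rfl

/-- A traversal of a path with distinct vertices has distinct vertices. -/
theorem nodup_trav {p : VSeq V} (h : p.verts.Nodup) (b : Bool) :
    (bif b then p.verts.reverse else p.verts).Nodup := by
  cases b <;> simpa [List.nodup_reverse] using h

/-- A traversal of a path of `G` is a walk of `G`. -/
theorem isChain_trav {G : SimpleGraph V} {p : VSeq V} (h : List.IsChain G.Adj p.verts)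
    (b : Bool) : List.IsChain G.Adj (bif b then p.verts.reverse else p.verts) := by
  cases b
  · exact h
  · simp only [cond_true]
    rw [List.isChain_reverse]
    exact List.IsChain.imp (fun a b hab => G.adj_symm hab) h

end VSeq

/-! ### Path covers -/

section Cover

variable {V : Type*} [DecidableEq V] {G : SimpleGraph V} {S : Finset V} {P : List (VSeq V)}

/-- Paths of a cover have distinct vertices. -/
theorem IsCoverOf.nodup_verts (h : IsCoverOf G S P) {p : VSeq V} (hp : p ∈ P) : p.verts.Nodup :=
  (List.nodup_flatten.1 h.1).1 _ (List.mem_map.2 ⟨p, hp, rfl⟩)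

/-- Distinct paths of a cover are vertex-disjoint. -/
theorem IsCoverOf.disjoint (h : IsCoverOf G S P) {i j : ℕ} (hi : i < P.length) (hj : j < P.length)
    (hij : i ≠ j) : List.Disjoint (P[i]).verts (P[j]).verts := by
  have hpw := (List.nodup_flatten.1 h.1).2
  rw [List.pairwise_map, List.pairwise_iff_getElem] at hpw
  rcases Nat.lt_or_gt_of_ne hij with hlt | hlt
  · exact hpw i j hi hj hlt
  · exact (hpw j i hj hi hlt).symm

/-- A cover of `S` lists exactly the vertices of `S`. -/
theorem IsCoverOf.mem_iff (h : IsCoverOf G S P) {v : V} : v ∈ S ↔ ∃ p ∈ P, v ∈ p.verts := by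
  rw [← h.2.1, List.mem_toFinset, List.mem_flatten]
  constructor
  · rintro ⟨l, hl, hv⟩
    obtain ⟨p, hp, rfl⟩ := List.mem_map.1 hl
    exact ⟨p, hp, hv⟩
  · rintro ⟨p, hp, hv⟩
    exact ⟨p.verts, List.mem_map.2 ⟨p, hp, rfl⟩, hv⟩

/-- Vertices of a path of a cover of `S` lie in `S`. -/
theorem IsCoverOf.mem_of_mem_verts (h : IsCoverOf G S P) {p : VSeq V} (hp : p ∈ P) {v : V}
    (hv : v ∈ p.verts) : v ∈ S :=
  h.mem_iff.2 ⟨p, hp, hv⟩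

/-- Paths of a cover are walks of `G`. -/
theorem IsCoverOf.isChain (h : IsCoverOf G S P) {p : VSeq V} (hp : p ∈ P) :
    List.IsChain G.Adj p.verts :=
  h.2.2 p hp

end Cover


/-! ### From the Kotzig interface to the abstract two-coloured system -/

section Backward

open KotzigTrail Literature.Combinatorics.SimpleGraph

variable {V : Type*} [Fintype V] [DecidableEq V] (G : SimpleGraph V) [DecidableRel G.Adj]
  (F : Finset V)

omit [Fintype V] [DecidableEq V] in
/-- The end vertices of a labelled A-path lie in the declared labels (`false` = first end and
first label, `true` = last end and second label). -/
theorem endAt_mem_labAt {q : VSeq V × (Finset V × Finset V)}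
    (h : q.1.first ∈ q.2.1 ∧ q.1.last ∈ q.2.2) (b : Bool) :
    (bif b then q.1.last else q.1.first) ∈ (bif b then q.2.2 else q.2.1) := by
  cases b
  exacts [h.1, h.2]

/-- Members of a class key are neighbours. -/
theorem adj_of_mem_nbA {u a : V} (h : a ∈ nbA G F u) : G.Adj u a := (Finset.mem_filter.1 h).2

variable {G F}

/-! The half-edges of the abstract system are the path ends `(k, b)` (`b = false`: first vertex,
`b = true`: last vertex of the `k`-th path).  The label `la (k, b)` of an A-half-edge is the
declared label at that end, the label `lf (k, b)` of an F-half-edge is the class key of that end;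
both are carried as variables with their defining equations `hla`, `hlf`. -/

variable {PF : List (VSeq V)} {PA : List (VSeq V × (Finset V × Finset V))}
  {la : Fin PA.length × Bool → Finset V} {lf : Fin PF.length × Bool → Finset V}
  (hla : ∀ h, la h = bif h.2 then (PA[h.1]).2.2 else (PA[h.1]).2.1)
  (hlf : ∀ f, lf f = nbA G F (bif f.2 then (PF[f.1]).last else (PF[f.1]).first))

include hla hlf in
/-- Balance of `KotzigPred` is balance of the half-edge labels. -/
theorem balanced_of_slots (hbal : ∀ i, fSlots (nbA G F) PF i = aSlots PA i) (i : Finset V) :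
    (univ.filter fun f => lf f = i).card = (univ.filter fun h => la h = i).card := by
  rw [card_filter_prod_bool, card_filter_prod_bool]
  have h1 := hbal i
  unfold fSlots aSlots at h1
  rw [countP_eq_card_fin, countP_eq_card_fin, countP_eq_card_fin, countP_eq_card_fin] at h1
  simpa [hla, hlf] using h1

include hla hlf in
/-- Connectivity of the junction graph on the support is connectivity of the half-edge labels. -/
theorem closure_of_reachable (hbal : ∀ i, fSlots (nbA G F) PF i = aSlots PA i)
    (hconn : ∀ i j, 0 < fSlots (nbA G F) PF i → 0 < fSlots (nbA G F) PF j →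
      (junctionGraph (nbA G F) PF PA).Reachable i j)
    (h₀ : Fin PA.length × Bool) (P : Finset V → Prop) (hP₀ : P (la h₀))
    (hPA : ∀ h, P (la h) → P (la (Prod.map id not h)))
    (hPF : ∀ f, P (lf f) → P (lf (Prod.map id not f))) (h : Fin PA.length × Bool) :
    P (la h) := by
  have hsupp : ∀ h : Fin PA.length × Bool, 0 < fSlots (nbA G F) PF (la h) := by
    rintro ⟨k, b⟩
    rw [hbal, hla]
    unfold aSlots
    cases b
    · exact Nat.add_pos_left
        (List.countP_pos_iff.2 ⟨PA[k], List.getElem_mem k.2, by simp⟩) _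
    · exact Nat.add_pos_right _
        (List.countP_pos_iff.2 ⟨PA[k], List.getElem_mem k.2, by simp⟩)
  have lfF : ∀ (k : ℕ) (hk : k < PF.length), lf (⟨k, hk⟩, false) = nbA G F (PF[k]).first :=
    fun k hk => by rw [hlf]; rfl
  have lfT : ∀ (k : ℕ) (hk : k < PF.length), lf (⟨k, hk⟩, true) = nbA G F (PF[k]).last :=
    fun k hk => by rw [hlf]; rfl
  have laF : ∀ (k : ℕ) (hk : k < PA.length), la (⟨k, hk⟩, false) = (PA[k]).2.1 :=
    fun k hk => by rw [hla]; rfl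
  have laT : ∀ (k : ℕ) (hk : k < PA.length), la (⟨k, hk⟩, true) = (PA[k]).2.2 :=
    fun k hk => by rw [hla]; rfl
  have hcl : ∀ i j, (junctionGraph (nbA G F) PF PA).Adj i j → P i → P j := by
    intro i j hij hPi
    rw [junctionGraph, SimpleGraph.fromRel_adj] at hij
    obtain ⟨-, hr | hr⟩ := hij
    · rcases hr with ⟨p, hp, hpi, hpj⟩ | ⟨q, hq, hqi, hqj⟩
      · obtain ⟨k, hk, rfl⟩ := List.getElem_of_mem hp
        have h2 : P (lf (⟨k, hk⟩, true)) := hPF (⟨k, hk⟩, false) (by rw [lfF, hpi]; exact hPi)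
        rw [lfT, hpj] at h2
        exact h2
      · obtain ⟨k, hk, rfl⟩ := List.getElem_of_mem hq
        have h2 : P (la (⟨k, hk⟩, true)) := hPA (⟨k, hk⟩, false) (by rw [laF, hqi]; exact hPi)
        rw [laT, hqj] at h2
        exact h2
    · rcases hr with ⟨p, hp, hpj, hpi⟩ | ⟨q, hq, hqj, hqi⟩
      · obtain ⟨k, hk, rfl⟩ := List.getElem_of_mem hp
        have h2 : P (lf (⟨k, hk⟩, false)) := hPF (⟨k, hk⟩, true) (by rw [lfT, hpi]; exact hPi)
        rw [lfF, hpj] at h2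
        exact h2
      · obtain ⟨k, hk, rfl⟩ := List.getElem_of_mem hq
        have h2 : P (la (⟨k, hk⟩, false)) := hPA (⟨k, hk⟩, true) (by rw [laT, hqi]; exact hPi)
        rw [laF, hqj] at h2
        exact h2
  obtain ⟨w⟩ := hconn _ _ (hsupp h₀) (hsupp h)
  suffices key : ∀ {i j} (w : (junctionGraph (nbA G F) PF PA).Walk i j), P i → P j from
    key w hP₀
  intro i j w
  induction w with
  | nil => exact id
  | cons hadj w' ih => exact fun hPi => ih (hcl _ _ hadj hPi)

end Backward

/-- Registered sub-goal of `stub_kotzig` served by this file (`--supports stmt-PneNP-10637`):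
connectivity of the junction graph in closure form, `closure_of_reachable`. -/
theorem stub_kotzig_closure {V : Type*} [Fintype V] [DecidableEq V] {G : SimpleGraph V}
    [DecidableRel G.Adj] {F : Finset V} {PF : List (VSeq V)}
    {PA : List (VSeq V × (Finset V × Finset V))} {la : Fin PA.length × Bool → Finset V}
    {lf : Fin PF.length × Bool → Finset V}
    (hla : ∀ h, la h = bif h.2 then (PA[h.1]).2.2 else (PA[h.1]).2.1)
    (hlf : ∀ f, lf f = nbA G F (bif f.2 then (PF[f.1]).last else (PF[f.1]).first))
    (hbal : ∀ i, fSlots (nbA G F) PF i = aSlots PA i)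
    (hconn : ∀ i j, 0 < fSlots (nbA G F) PF i → 0 < fSlots (nbA G F) PF j →
      (junctionGraph (nbA G F) PF PA).Reachable i j)
    (h₀ : Fin PA.length × Bool) (P : Finset V → Prop) (hP₀ : P (la h₀))
    (hPA : ∀ h, P (la h) → P (la (Prod.map id not h)))
    (hPF : ∀ f, P (lf f) → P (lf (Prod.map id not f))) (h : Fin PA.length × Bool) : P (la h) :=
  closure_of_reachable hla hlf hbal hconn h₀ P hP₀ hPA hPF h

end Summit.PneNP.PneNP.Theorems.HamCompilesKC
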